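import Literature.Computability.QuantumComplexity.QAOARingObstruction
import HarnessLib

/-!
# Classical symmetries of QAOA (Shaydulin–Hadfield–Hogg–Safro 2021, Theorem 1 and Corollaries 1–2)

Topic `Literature/Computability/QuantumComplexity` (pub-qadeq lane); companion to
`QAOALevelOneMaxCut.lean` (FGG's QAOA objects, `qaoaStateP`, `outcomeProb`, `edgeExpectP`, `levelP`)
and `QAOARingObstruction.lean` (`globalFlip`, `disagree`, `ringGraph`, `ringHam`). It PROVES the
symmetry principle used throughout the QAOA literature (FGG §4 and Mbeng–Fazio–Santoro §3 invoke
translational invariance on the ring; Bravyi–Kliesch–Koenig–Tang use the bit-flip symmetry): a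
permutation of bit strings that commutes with the phase and mixing unitaries and fixes `|s⟩` leaves
every QAOA amplitude invariant (SHHS Lemma 1), in particular the printed Theorem 1 (`[A,C] = 0 =
[A,B]` ⇒ `Prob_p(x) = Prob_p(a(x))`), Corollary 2 (graph automorphisms of a MaxCut instance), the
bit-flip instance `Prob_p(x̄) = Prob_p(x)`, the invariance of the edge expectations under
automorphisms, and translational invariance on the ring (`F_p = n ⟨C_{⟨0,1⟩}⟩`).

HONEST FRAMING: instance-level adjudication of specific advantage claims; no claim about BQP vs
BPP or the summit. These are exact finite identities about the ansatz; nothing here concerns the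
performance of any device or classical algorithm.

## Sources (held texts, read at the cited places)

* [ShaydulinHadfieldHoggSafro2021] R. Shaydulin, S. Hadfield, T. Hogg, I. Safro, *Classical symmetries
  and the Quantum Approximate Optimization Algorithm*, Quantum Inf. Process. 20, 359 (2021) =
  arXiv:2012.04713 (`lit read arxiv:2012.04713`, tex chunks p0003, p0006–p0009). §2: “a symmetry of
  the objective function `f(x)` is a transformation `a ∈ S_{2^n}` … such that … `f(x) = f(a(x))`”, “On
  qubits, each symmetry `a(x)` … `A|x⟩ = |a(x)⟩`”. **Theorem 1.** “Consider a depth-p QAOA state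
  `|β,γ⟩_p = U_B(β_p)U_C(γ_p)…U_B(β₁)U_C(γ₁)|s⟩` with objective Hamiltonian `C`, transverse-field mixing
  Hamiltonian `B`, and initial state `|s⟩ = |+⟩^{⊗n}`. Given a classical symmetry matrix `A ∈ S_{2^n}`
  implementing the permutation `A|x⟩ = |a(x)⟩` … such that (i) `[A,C] = 0` and (ii) `[A,B] = 0`, then
  for all `p, β, γ`, the measurement probability of all bit strings connected by `A` is the same:
  `∀x ∈ {0,1}^n Prob_p(x) = Prob_p(a(x))`.” **Lemma 1.** “Suppose we know a symmetry `A ∈ S_{2^n}`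
  acting as `A|x⟩ = |a(x)⟩` … such that `[A,U_C(γ)] = 0 ∀γ` … and `[A,U_B(β)] = 0 ∀β` … Then
  solution probability amplitudes are invariant under `A`”; proof: “`⟨a(x)|β,γ⟩ = ⟨x|A†U_B(β_p)⋯
  U_C(γ₁)|s⟩ = ⟨x|U_B(β_p)⋯U_C(γ₁)A†|s⟩ = ⟨x|β,γ⟩` … Here we have used the commutation assumptions
  for the first equality and `A†|s⟩ = |s⟩` for the second one.” “the conditions `[A,C] = 0` and
  `[A,B] = 0` of the theorem imply `[A,U_C(γ)] = 0` and `[A,U_B(β)] = 0` … by expanding the matrix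
  exponential as a power series”. **Corollary 1.** “Suppose a group of variable permutations leaves
  the objective function invariant. Then QAOA output probabilities are the same across all bit
  strings connected by such permutations, for all fixed choices of QAOA parameters and depth.” “for
  the transverse field mixer `B = Σ_j X_j`, qubit permutations `A ∈ S_n ⊂ S_{2^n}` always satisfy
  condition (ii)”. **Corollary 2.** “Consider an n-vertex graph `G` with some (label-independent)
  objective function … Suppose we know a subgroup of graph automorphisms `𝒜_G ⊆ Aut(G)` … Then for all
  `p, β, γ` … `Prob_p(x) = Prob_p(a_j(x))`.” “An example satisfying `[A′,B] = 0` but where `A′ ∉ S_n`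
  is `A′ = X₁X₂…X_n` … corresponding to the well-known ℤ₂-symmetry of [MaxCut]”.
* [MbengFazioSantoro2019] G. B. Mbeng, R. Fazio, G. Santoro, arXiv:1906.08948, §3 (tex chunk p0007):
  “because of translational invariance we can write the residual energy … as `ε^res_P(γ,β) =
  ⟨ψ_P(γ,β)| (σ^z_{j_s}σ^z_{j_s+1} + 1)/2 |ψ_P(γ,β)⟩`, where `j_s` is any site of the chain”.
* [FarhiGoldstoneGutmann2014] arXiv:1411.4028, §4 (the ring of disagrees).

## What is formalised

* `permMatrix a` (`A|y⟩ = |a(y)⟩` for a permutation `a` of `{0,1}^V`), `permMatrix_mulVec`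
  (`(Aψ)(x) = ψ(a⁻¹x)`), `commute_permMatrix_diagonal` / **`commute_permMatrix_costOp`** (`[A,C] = 0`
  when `C(a(x)) = C(x) ∀x`, SHHS condition (i′)).
* **SHHS Lemma 1**, `mulVec_qaoaStateP_eq_of_commute` (`A` commuting with every `U_C(γ)`, `U_B(β)` and
  fixing `|s⟩` fixes `|γ,β⟩`); `commute_costUnitary_of_commute_costOp` / `commute_mixUnitary_of_commute_mixOp`
  (the power-series remark, via `Commute.exp_right`); **SHHS Theorem 1**, `outcomeProb_perm`
  (`Prob_p(a(x)) = Prob_p(x)` under `[A,C] = 0 = [A,B]`).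
* Variable permutations: `relabel φ` (`x ↦ x ∘ φ⁻¹`), `permMatrix_relabel_mul_tensorAll` (qubit
  permutations act on tensor products by permuting the factors), hence condition (ii) for free
  (`commute_permMatrix_relabel_mixOp`, “qubit permutations always satisfy condition (ii)”) and
  `permMatrix_relabel_mul_sitePauli`; for a graph automorphism `φ : G ≃g G`, `cutValue_comp_iso`
  (`C(x ∘ φ) = C(x)`), **Corollary 2** `outcomeProb_comp_iso` (`Prob_p(x ∘ φ) = Prob_p(x)`), and the
  edge-level consequence **`edgeExpectP_map_iso`** (`⟨C_{⟨φa,φb⟩}⟩_p = ⟨C_{⟨a,b⟩}⟩_p`).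
* The ℤ₂ instance: `outcomeProb_not` (`Prob_p(x̄) = Prob_p(x)`, SHHS's `A′ = X₁⋯X_n`; BKKT's “p(x) =
  p(x̄)”), from the parent's `commute_globalFlip_qaoaUnitaryP`.
* The ring: `ringShift` (translation is an automorphism of `ringGraph n`), **`edgeExpectP_ringGraph_shift`**
  and **`levelP_ringGraph_eq`** (`F_p = n · ⟨C_{⟨0,1⟩}⟩_p`, MFS's “for any site of the chain”, `n ≥ 3`).
* NOT formalised: SHHS's group-theoretic dimension count (their Theorem 2), the symmetry measures and
  the machine-learning sections.

0 named facts, 0 sorry.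
-/

noncomputable section

open Matrix Finset

namespace Literature.Computability.QuantumComplexity

namespace QAOA

variable {V : Type*} [Fintype V] [DecidableEq V]

/-! ### Permutations of bit strings as matrices -/

/-- **The classical symmetry matrix `A` of a permutation `a` of `{0,1}^V`: `A|y⟩ = |a(y)⟩`.** [cite:
ShaydulinHadfieldHoggSafro2021, §2 (“On qubits, each symmetry a(x) … A|x⟩ = |a(x)⟩”)] -/
def permMatrix (a : (V → Bool) ≃ (V → Bool)) : Matrix (V → Bool) (V → Bool) ℂ :=
  fun x y => if x = a y then 1 else 0

/-- `(Aψ)(x) = ψ(a⁻¹(x))`. [cite: ShaydulinHadfieldHoggSafro2021, §2 (A|x⟩ = |a(x)⟩)] -/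
theorem permMatrix_mulVec (a : (V → Bool) ≃ (V → Bool)) (v : (V → Bool) → ℂ) :
    permMatrix a *ᵥ v = fun x => v (a.symm x) := by
  funext x
  rw [mulVec, dotProduct, Finset.sum_eq_single (a.symm x)]
  · simp [permMatrix]
  · intro y _ hy
    rw [permMatrix, if_neg (fun h => hy (by rw [h, Equiv.symm_apply_apply])), zero_mul]
  · exact fun h => absurd (Finset.mem_univ _) h

/-- Entries of `A M`: `(A M)_{x,y} = M_{a⁻¹x, y}`. [folklore] -/
private theorem permMatrix_mul_apply (a : (V → Bool) ≃ (V → Bool)) (M : Matrix (V → Bool) (V → Bool) ℂ)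
    (x y : V → Bool) : (permMatrix a * M) x y = M (a.symm x) y := by
  rw [Matrix.mul_apply, Finset.sum_eq_single (a.symm x)]
  · simp [permMatrix]
  · intro z _ hz
    rw [permMatrix, if_neg (fun h => hz (by rw [h, Equiv.symm_apply_apply])), zero_mul]
  · exact fun h => absurd (Finset.mem_univ _) h

/-- Entries of `M A`: `(M A)_{x,y} = M_{x, a y}`. [folklore] -/
private theorem mul_permMatrix_apply (a : (V → Bool) ≃ (V → Bool)) (M : Matrix (V → Bool) (V → Bool) ℂ)
    (x y : V → Bool) : (M * permMatrix a) x y = M x (a y) := by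
  rw [Matrix.mul_apply, Finset.sum_eq_single (a y)]
  · simp [permMatrix]
  · intro z _ hz
    rw [permMatrix, if_neg (Ne.symm hz ∘ Eq.symm), mul_zero]
  · exact fun h => absurd (Finset.mem_univ _) h

/-- `A` fixes the uniform superposition: `A|s⟩ = |s⟩`. [cite: ShaydulinHadfieldHoggSafro2021, proof of
Lemma 1 (“A†|s⟩ = |s⟩”)] -/
theorem permMatrix_mulVec_plusState (a : (V → Bool) ≃ (V → Bool)) :
    permMatrix a *ᵥ (plusState : (V → Bool) → ℂ) = plusState := by
  rw [permMatrix_mulVec]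
  rfl

/-- `A · diag(d) = diag(d ∘ a⁻¹) · A`. [folklore] -/
private theorem permMatrix_mul_diagonal (a : (V → Bool) ≃ (V → Bool)) (d : (V → Bool) → ℂ) :
    permMatrix a * diagonal d = diagonal (d ∘ a.symm) * permMatrix a := by
  ext x y
  rw [permMatrix_mul_apply, diagonal_apply, Matrix.mul_apply, Finset.sum_eq_single x]
  · rw [diagonal_apply_eq, permMatrix, Function.comp_apply]
    by_cases h : x = a y
    · rw [if_pos h, if_pos (by rw [h, Equiv.symm_apply_apply]), mul_one]
    · rw [if_neg h, if_neg (fun h' => h (by rw [← h', Equiv.apply_symm_apply])), mul_zero]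
  · intro z _ hz
    rw [diagonal_apply_ne _ (Ne.symm hz), zero_mul]
  · exact fun h => absurd (Finset.mem_univ _) h

/-- **SHHS condition (i′): `[A, C] = 0` iff `C(a(x)) = C(x)` for all `x`** — here the sufficient
direction for any diagonal `C`. [cite: ShaydulinHadfieldHoggSafro2021, Thm. 1 (“[A,C] = 0 = [A,B] if
and only if (i′) c(a(x)) = c(x) …”)] -/
theorem commute_permMatrix_diagonal {a : (V → Bool) ≃ (V → Bool)} {d : (V → Bool) → ℂ}
    (h : ∀ x, d (a x) = d x) : Commute (permMatrix a) (diagonal d) := by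
  rw [Commute, SemiconjBy, permMatrix_mul_diagonal]
  congr 2
  funext x
  rw [Function.comp_apply, ← h (a.symm x), Equiv.apply_symm_apply]

variable (G : SimpleGraph V) [DecidableRel G.Adj]

/-- **`[A, C] = 0` when the cut value is `a`-invariant.** [cite: ShaydulinHadfieldHoggSafro2021, Thm. 1
(condition (i′) c(a(x)) = c(x))] -/
theorem commute_permMatrix_costOp {a : (V → Bool) ≃ (V → Bool)} (h : ∀ x, cutValue G (a x) = cutValue G x) :
    Commute (permMatrix a) (costOp G) := by
  rw [costOp_eq_diagonal]
  exact commute_permMatrix_diagonal fun x => by rw [h x]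

/-! ### Lemma 1 and Theorem 1 -/

/-- `[A, C] = 0 ⇒ [A, U_C(γ)] = 0` (“by expanding the matrix exponential as a power series”). [cite:
ShaydulinHadfieldHoggSafro2021, §3 (remark before the proof of Thm. 1)] -/
theorem commute_costUnitary_of_commute_costOp {A : Matrix (V → Bool) (V → Bool) ℂ}
    (h : Commute A (costOp G)) (γ : ℝ) : Commute A (costUnitary G γ) := by
  rw [costUnitary_eq_exp]
  exact (h.smul_right _).exp_right

/-- `[A, B] = 0 ⇒ [A, U_B(β)] = 0`. [cite: ShaydulinHadfieldHoggSafro2021, §3 (remark before the proof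
of Thm. 1)] -/
theorem commute_mixUnitary_of_commute_mixOp {A : Matrix (V → Bool) (V → Bool) ℂ}
    (h : Commute A mixOp) (β : ℝ) : Commute A (mixUnitary β : Matrix (V → Bool) (V → Bool) ℂ) := by
  rw [mixUnitary_eq_exp]
  exact (h.smul_right _).exp_right

/-- `A` commuting with all `U_C(γ)`, `U_B(β)` commutes with the level-`p` circuit. [cite:
ShaydulinHadfieldHoggSafro2021, proof of Lemma 1 (first equality)] -/
theorem commute_qaoaUnitaryP_of_commute {A : Matrix (V → Bool) (V → Bool) ℂ}
    (hC : ∀ γ, Commute A (costUnitary G γ)) (hB : ∀ β, Commute A (mixUnitary β)) (p : ℕ) (γ β : Fin p → ℝ) :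
    Commute A (qaoaUnitaryP G p γ β) := by
  induction p with
  | zero => rw [qaoaUnitaryP]; exact Commute.one_right _
  | succ p ih => rw [qaoaUnitaryP]; exact ((hB _).mul_right (hC _)).mul_right (ih _ _)

/-- **SHHS Lemma 1 (amplitude invariance):** if `A` commutes with every `U_C(γ)` and `U_B(β)` and
`A|s⟩ = |s⟩`, then `A|γ,β⟩ = |γ,β⟩` at every level `p`. [cite: ShaydulinHadfieldHoggSafro2021, Lemma 1
and its proof (“⟨a(x)|β,γ⟩ = ⟨x|A†U_B(β_p)⋯U_C(γ₁)|s⟩ = ⟨x|U_B(β_p)⋯U_C(γ₁)A†|s⟩ = ⟨x|β,γ⟩”)] -/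
theorem mulVec_qaoaStateP_eq_of_commute {A : Matrix (V → Bool) (V → Bool) ℂ}
    (hC : ∀ γ, Commute A (costUnitary G γ)) (hB : ∀ β, Commute A (mixUnitary β))
    (hs : A *ᵥ plusState = plusState) (p : ℕ) (γ β : Fin p → ℝ) :
    A *ᵥ qaoaStateP G p γ β = qaoaStateP G p γ β := by
  rw [qaoaStateP, mulVec_mulVec, (commute_qaoaUnitaryP_of_commute G hC hB p γ β).eq, ← mulVec_mulVec, hs]

/-- **SHHS Theorem 1:** for a classical symmetry matrix `A|x⟩ = |a(x)⟩` with `[A, C] = 0` and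
`[A, B] = 0`, `Prob_p(a(x)) = Prob_p(x)` for all `p`, all angles and all `x`. [cite:
ShaydulinHadfieldHoggSafro2021, Thm. 1] -/
theorem outcomeProb_perm (a : (V → Bool) ≃ (V → Bool)) (hC : Commute (permMatrix a) (costOp G))
    (hB : Commute (permMatrix a) mixOp) (p : ℕ) (γ β : Fin p → ℝ) (x : V → Bool) :
    outcomeProb G p γ β (a x) = outcomeProb G p γ β x := by
  have h := mulVec_qaoaStateP_eq_of_commute G (commute_costUnitary_of_commute_costOp G hC)
    (commute_mixUnitary_of_commute_mixOp hB) (permMatrix_mulVec_plusState a) p γ β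
  have hx := congr_fun h (a x)
  rw [permMatrix_mulVec] at hx
  simp only [Equiv.symm_apply_apply] at hx
  unfold outcomeProb
  rw [hx]

/-! ### Variable (qubit) permutations: Corollaries 1–2 -/

/-- The bit-string permutation of a variable permutation `φ`: the value of variable `i` moves to
`φ i` (`(relabel φ x)(φ i) = x i`, i.e. `relabel φ x = x ∘ φ⁻¹`). [cite: ShaydulinHadfieldHoggSafro2021,
Cor. 1 (“variable permutations”)] -/
def relabel (φ : V ≃ V) : (V → Bool) ≃ (V → Bool) where
  toFun x := x ∘ φ.symm
  invFun x := x ∘ φ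
  left_inv x := by ext i; simp
  right_inv x := by ext i; simp

omit [Fintype V] [DecidableEq V] in
/-- Unfolding of `relabel`. [folklore] -/
@[simp] private theorem relabel_apply (φ : V ≃ V) (x : V → Bool) : relabel φ x = x ∘ φ.symm := rfl

omit [Fintype V] [DecidableEq V] in
/-- Unfolding of `relabel⁻¹`. [folklore] -/
@[simp] private theorem relabel_symm_apply (φ : V ≃ V) (x : V → Bool) : (relabel φ).symm x = x ∘ φ := rfl

/-- **Qubit permutations permute tensor factors:** `A (⊗ᵢ gᵢ) = (⊗ⱼ g_{φ⁻¹ j}) A`. [cite: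
ShaydulinHadfieldHoggSafro2021, §3 (“qubit permutations A ∈ S_n ⊂ S_{2^n} always satisfy condition
(ii)”)] -/
theorem permMatrix_relabel_mul_tensorAll (φ : V ≃ V) (g : V → Matrix Bool Bool ℂ) :
    permMatrix (relabel φ) * tensorAll g = tensorAll (g ∘ φ.symm) * permMatrix (relabel φ) := by
  ext x y
  rw [permMatrix_mul_apply, mul_permMatrix_apply, tensorAll_apply, tensorAll_apply, relabel_symm_apply,
    relabel_apply]
  rw [← Equiv.prod_comp φ (fun j => (g ∘ φ.symm) j (x j) ((y ∘ φ.symm) j))]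
  refine Finset.prod_congr rfl fun i _ => ?_
  simp

/-- **Condition (ii) for qubit permutations: `[A, B] = 0`.** [cite: ShaydulinHadfieldHoggSafro2021, §3
(“for the transverse field mixer B = Σ_j X_j, qubit permutations … always satisfy condition (ii)”)] -/
theorem commute_permMatrix_relabel_mixUnitary (φ : V ≃ V) (β : ℝ) :
    Commute (permMatrix (relabel φ)) (mixUnitary β : Matrix (V → Bool) (V → Bool) ℂ) := by
  rw [Commute, SemiconjBy, mixUnitary, permMatrix_relabel_mul_tensorAll]
  rfl

/-- `A σ^Q_w = σ^Q_{φ w} A` for a qubit permutation. [cite: ShaydulinHadfieldHoggSafro2021, §3 (qubit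
permutations)] -/
theorem permMatrix_relabel_mul_sitePauli (φ : V ≃ V) (Q : Pauli) (w : V) :
    permMatrix (relabel φ) * sitePauli Q w = sitePauli Q (φ w) * permMatrix (relabel φ) := by
  rw [sitePauli, sitePauli, pauliString_eq, pauliString_eq, permMatrix_relabel_mul_tensorAll]
  congr 2
  funext j
  simp only [Function.comp_apply, siteWord]
  by_cases h : j = φ w
  · subst h; simp
  · rw [Function.update_of_ne (fun h' => h (by rw [← h', Equiv.apply_symm_apply])),
      Function.update_of_ne h]

/-- `[A, B] = 0` for a qubit permutation, `B = Σ_w σ^x_w`. [cite: ShaydulinHadfieldHoggSafro2021, §3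
(qubit permutations satisfy condition (ii))] -/
theorem commute_permMatrix_relabel_mixOp (φ : V ≃ V) :
    Commute (permMatrix (relabel φ)) (mixOp : Matrix (V → Bool) (V → Bool) ℂ) := by
  rw [Commute, SemiconjBy, mixOp, Finset.mul_sum, Finset.sum_mul]
  simp_rw [permMatrix_relabel_mul_sitePauli]
  exact Equiv.sum_comp φ (fun w => sitePauli Pauli.X w * permMatrix (relabel φ))

variable {G}

omit [Fintype V] [DecidableEq V] in
/-- The cut indicator transported by a map of vertices. [folklore] -/
private theorem cutInd_comp (φ : V → V) (x : V → Bool) (e : Sym2 V) :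
    cutInd (x ∘ φ) e = cutInd x (Sym2.map φ e) := by
  induction e using Sym2.ind with
  | h a b => rw [Sym2.map_mk, cutInd_mk, cutInd_mk]; rfl

omit [DecidableEq V] in
/-- **A graph automorphism is a symmetry of the MaxCut objective: `C(x ∘ φ) = C(x)`.** [cite:
ShaydulinHadfieldHoggSafro2021, Cor. 2 (“graph automorphisms 𝒜_G ⊆ Aut(G)” are symmetries of a
label-independent objective)] -/
theorem cutValue_comp_iso (φ : G ≃g G) (x : V → Bool) : cutValue G (x ∘ φ) = cutValue G x := by
  rw [cutValue, cutValue]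
  simp_rw [cutInd_comp]
  refine Finset.sum_nbij' (fun e => Sym2.map φ e) (fun e => Sym2.map φ.symm e) ?_ ?_ ?_ ?_ ?_
  · intro e he
    rw [SimpleGraph.mem_edgeFinset] at he ⊢
    exact (SimpleGraph.Iso.map_mem_edgeSet_iff φ).2 he
  · intro e he
    rw [SimpleGraph.mem_edgeFinset] at he ⊢
    exact (SimpleGraph.Iso.map_mem_edgeSet_iff φ.symm).2 he
  · intro e _
    induction e using Sym2.ind with
    | h u v => simp
  · intro e _
    induction e using Sym2.ind with
    | h u v => simp
  · intro e _; rfl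

/-- `[A, C] = 0` for a graph automorphism. [cite: ShaydulinHadfieldHoggSafro2021, Cor. 2 (proof: “Each
permutation matrix A ∈ S_n representing a graph automorphism satisfies the conditions of the
theorem”)] -/
theorem commute_permMatrix_relabel_costOp (φ : G ≃g G) : Commute (permMatrix (relabel φ.toEquiv)) (costOp G) :=
  commute_permMatrix_costOp G fun x => by
    rw [relabel_apply]
    exact cutValue_comp_iso φ.symm x

/-- **SHHS Corollary 2 (graph automorphisms): `Prob_p(x ∘ φ) = Prob_p(x)`** for every automorphism
`φ` of the MaxCut instance, every level and all angles. [cite: ShaydulinHadfieldHoggSafro2021, Cor. 1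
and Cor. 2] -/
theorem outcomeProb_comp_iso (φ : G ≃g G) (p : ℕ) (γ β : Fin p → ℝ) (x : V → Bool) :
    outcomeProb G p γ β (x ∘ φ) = outcomeProb G p γ β x := by
  have h := outcomeProb_perm G (relabel φ.symm.toEquiv) (commute_permMatrix_relabel_costOp φ.symm)
    (commute_permMatrix_relabel_mixOp _) p γ β x
  rw [relabel_apply] at h
  exact h

/-- **Edge expectations are invariant under automorphisms: `⟨C_{⟨φa, φb⟩}⟩_p = ⟨C_{⟨a,b⟩}⟩_p`.** [cite:
ShaydulinHadfieldHoggSafro2021, Cor. 2 (probabilities invariant under Aut(G))] [cite: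
MbengFazioSantoro2019, §3 (“because of translational invariance … where j_s is any site of the
chain”)] -/
theorem edgeExpectP_map_iso (φ : G ≃g G) (p : ℕ) (γ β : Fin p → ℝ) (a b : V) :
    edgeExpectP G p γ β s(φ a, φ b) = edgeExpectP G p γ β s(a, b) := by
  rw [edgeExpectP, edgeExpectP, finalStateP, trace_edgeTerm_mul_conj, trace_edgeTerm_mul_conj]
  congr 1
  unfold disagree
  rw [← Equiv.sum_comp (relabel φ.toEquiv)
    (fun z => (cutInd z s(φ a, φ b) : ℝ) * ‖stateVec (qaoaUnitaryP G p γ β) z‖ ^ 2)]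
  refine Finset.sum_congr rfl fun z _ => ?_
  have hψ : ‖stateVec (qaoaUnitaryP G p γ β) (relabel φ.toEquiv z)‖ ^ 2 =
      ‖stateVec (qaoaUnitaryP G p γ β) z‖ ^ 2 :=
    outcomeProb_comp_iso φ.symm p γ β z
  have hc : cutInd (relabel φ.toEquiv z) s(φ a, φ b) = cutInd z s(a, b) := by
    rw [relabel_apply, cutInd_mk, cutInd_mk, Function.comp_apply, Function.comp_apply,
      show φ.toEquiv.symm (φ a) = a from φ.toEquiv.symm_apply_apply a,
      show φ.toEquiv.symm (φ b) = b from φ.toEquiv.symm_apply_apply b]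
  rw [hψ, hc]

/-! ### The bit-flip symmetry as an instance -/

/-- **`Prob_p(x̄) = Prob_p(x)`**: the all-bits flip `A′ = X₁X₂…X_n` is a QAOA symmetry of MaxCut
(“the well-known ℤ₂-symmetry of that problem”; BKKT's “p(x) = p(x̄)”). [cite:
ShaydulinHadfieldHoggSafro2021, §3 (“An example satisfying [A′,B] = 0 but where A′ ∉ S_n is A′ =
X₁X₂…X_n”)] [cite: BravyiKlieschKoenigTang2020, Introduction (“Note that p(x) = p(x̄) since Uφ is
ℤ₂-symmetric”)] -/
theorem outcomeProb_not (p : ℕ) (γ β : Fin p → ℝ) (x : V → Bool) :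
    outcomeProb G p γ β (fun i => !x i) = outcomeProb G p γ β x := by
  -- `X^{⊗n}` is the permutation matrix of the bit flip
  let a : (V → Bool) ≃ (V → Bool) :=
    { toFun := fun x i => !x i, invFun := fun x i => !x i,
      left_inv := fun x => by ext i; simp, right_inv := fun x => by ext i; simp }
  have hA : (globalFlip : Matrix (V → Bool) (V → Bool) ℂ) = permMatrix a := by
    ext x y
    rw [globalFlip, pauliString_eq, tensorAll_apply, permMatrix]
    by_cases h : x = a y
    · rw [if_pos h, Finset.prod_eq_one]
      intro i _
      rw [h]
      show Pauli.X.mat (!(y i)) (y i) = 1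
      cases y i <;> rfl
    · rw [if_neg h]
      obtain ⟨i, hi⟩ : ∃ i, x i ≠ !y i := by
        by_contra hc
        push Not at hc
        exact h (funext hc)
      exact Finset.prod_eq_zero (Finset.mem_univ i) (by
        rw [Pauli.mat_X_apply, if_pos]
        cases hx : x i <;> cases hy : y i <;> simp_all)
  have h := mulVec_qaoaStateP_eq_of_commute G (A := permMatrix a)
    (fun γ' => hA ▸ commute_globalFlip_costUnitary G γ') (fun β' => hA ▸ commute_globalFlip_mixUnitary β')
    (permMatrix_mulVec_plusState a) p γ β
  have hx := congr_fun h (a x)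
  rw [permMatrix_mulVec] at hx
  simp only [Equiv.symm_apply_apply] at hx
  unfold outcomeProb
  rw [show (fun i => !x i) = a x from rfl, hx]

/-! ### Translational invariance on the ring -/

variable {n : ℕ} [NeZero n]

/-- **Translation by `t` is an automorphism of the ring `ℤ_n`.** [cite: MbengFazioSantoro2019, §3
(“translational invariance of H_z, H_x and of the initial state”)] -/
def ringShift (t : ZMod n) : ringGraph n ≃g ringGraph n where
  toEquiv := Equiv.addRight t
  map_rel_iff' := by
    intro a b
    simp only [Equiv.coe_addRight, ringGraph]
    constructor
    · rintro ⟨h1, h2⟩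
      refine ⟨fun h => h1 (by rw [h]), ?_⟩
      rcases h2 with h | h
      · exact Or.inl (add_right_cancel (b := t) (by rw [h]; ring))
      · exact Or.inr (add_right_cancel (b := t) (by rw [h]; ring))
    · rintro ⟨h1, h2⟩
      refine ⟨fun h => h1 (add_right_cancel h), ?_⟩
      rcases h2 with h | h
      · exact Or.inl (by rw [h]; ring)
      · exact Or.inr (by rw [h]; ring)

/-- **Translational invariance on the ring:** `⟨C_{⟨j, j+1⟩}⟩_p = ⟨C_{⟨0,1⟩}⟩_p` for every `j`
(“where `j_s` is any site of the chain”). [cite: MbengFazioSantoro2019, §3] [cite: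
FarhiGoldstoneGutmann2014, §4 (the ring of disagrees)] -/
theorem edgeExpectP_ringGraph_shift (p : ℕ) (γ β : Fin p → ℝ) (j : ZMod n) :
    edgeExpectP (ringGraph n) p γ β s(j, j + 1) = edgeExpectP (ringGraph n) p γ β s(0, 1) := by
  have h := edgeExpectP_map_iso (ringShift j) p γ β (0 : ZMod n) 1
  have h0 : (ringShift j) (0 : ZMod n) = j := by show 0 + j = j; rw [zero_add]
  have h1 : (ringShift j) (1 : ZMod n) = j + 1 := by show 1 + j = j + 1; rw [add_comm]
  rw [h0, h1] at h
  exact h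

/-- **`F_p = n · ⟨C_{⟨0,1⟩}⟩_p` on the ring** (`n ≥ 3`): by translational invariance the residual
energy is read off any one link. [cite: MbengFazioSantoro2019, §3 (eq. “ε^res_P(γ,β) = ⟨ψ_P|
(σ^z_{j_s}σ^z_{j_s+1} + 1)/2 |ψ_P⟩, where j_s is any site”)] -/
theorem levelP_ringGraph_eq (h3 : 3 ≤ n) (p : ℕ) (γ β : Fin p → ℝ) :
    levelP (ringGraph n) p γ β = n * edgeExpectP (ringGraph n) p γ β s(0, 1) := by
  rw [levelP, costOp_ringGraph h3, ringHam, Finset.sum_mul, trace_sum]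
  rw [Finset.sum_congr rfl fun i _ => (edgeExpectP_ringGraph_shift p γ β i :
    (edgeTerm s(i, i + 1) * finalStateP (ringGraph n) p γ β).trace = _), Finset.sum_const, Finset.card_univ,
    ZMod.card, nsmul_eq_mul]

end QAOA

end Literature.Computability.QuantumComplexity
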